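import Literature.Geometry.Kaehler.ComplexTorusHilbertModularKernelSumsCuspSector
import Literature.Geometry.Kaehler.ComplexTorusHilbertModularQuotientVolume
import Mathlib.MeasureTheory.Integral.DominatedConvergence
import HarnessLib

/-!
# Freitag, *Hilbert modular forms*, Ch. II §3 Corollary 3.1₁: termwise integration of `Σ_{M ∈ Γ−Γ_∞} k(M,z)` over `V_∞`

[cite: Freitag1990, Ch. II §3 Corollary 3.1₁, p. 91] (held `book:freitag1990-hilbert-modular-forms`, chunk p0054, VERBATIM):
«**3.1₁ Corollary.** The series `Σ_{M ∈ Γ−Γ_∞} k(M, z)` may be integrated term by term over `V_∞`.» (It follows Proposition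
3.1: «The series `Σ_{M ∈ Γ−Γ_∞} |k(M,z)|` is bounded on `V_∞`», the cusp sector having finite invariant volume, Ch. II §1
Remark 1.4.)

Formalised for the tree's carrier (`Γ ∼ Γ_K`, `F` totally real, `k(M, z) = ∏_σ traceTerm …`, `r ≥ 2`) on the tree's cusp sectors
`V(Γ, C') ⊂ (RealPlace F → ℍ)` with Mathlib's `volume` = Freitag's `dω` (`…HilbertModularFundamentalDomain`), for all
`C' ≥ C₀(Γ)`, `C' > 0` (where Proposition 3.1 is available, `…KernelSumsCuspSector`):
* §1 measurability of the terms and countability of `Γ − Γ_∞`;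
* §2 **Corollary 3.1₁**: `Σ_M ∫_{V} ‖k(M, z)‖ dω < ∞` (Proposition 3.1's uniform bound times `vol(V) < ∞` of
  `…QuotientVolume`), the sum of the norms is integrable on `V`, and
  `∫_V Σ_{M ∈ Γ−Γ_∞} k(M, z) dω = Σ_{M ∈ Γ−Γ_∞} ∫_V k(M, z) dω` (Mathlib's `integral_tsum`).
Theorems only; no definitions, no named facts (net debt 0).

## References
* [Freitag1990] E. Freitag, *Hilbert modular forms*, Springer 1990, Ch. II §3 Corollary 3.1₁ (p. 91), Proposition 3.1;
  Ch. II §1 Remark 1.4.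
-/

noncomputable section

open scoped Matrix MatrixGroups Classical NNReal ENNReal Topology ComplexConjugate UpperHalfPlane
open Set Filter Complex MeasureTheory

namespace Literature.NumberTheory.Automorphic.HilbertModular

open _root_.NumberField _root_.NumberField.InfinitePlace
open Literature.Geometry.Kaehler.ComplexTorus Literature.Geometry.Kaehler.ComplexTorus.HilbertModularFamily
open Literature.Analysis.Complex.SelbergTrace

variable {F : Type*} [Field F] [NumberField F]

/-! ## §1 Measurability and countability -/

/-- `z ↦ k_r(a,b,c,d)(z)` is measurable (a rational function of `z`, `z̄`, `Im z`). [cite: Freitag1990, Ch. II §2 p. 84] -/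
theorem measurable_traceTerm (r : ℕ) (a b c d : ℝ) : Measurable fun z : ℂ ↦ traceTerm r a b c d z := by
  unfold traceTerm
  have h1 : Measurable fun z : ℂ ↦ ((2 : ℂ) * I * (z.im : ℂ)) ^ (2 * r) :=
    ((measurable_const.mul (Complex.measurable_ofReal.comp Complex.measurable_im))).pow_const _
  have h2 : Measurable fun z : ℂ ↦ (((a : ℂ) * z + b) - conj z * ((c : ℂ) * z + d)) ^ (2 * r) :=
    (((measurable_const.mul measurable_id).add measurable_const).sub
      (Complex.continuous_conj.measurable.mul ((measurable_const.mul measurable_id).add measurable_const))).pow_const _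
  exact h1.div h2

/-- `ζ ↦ k(M, ζ) = ∏_σ k_r(M^σ)(ζ_σ)` is measurable on `ℍⁿ = (RealPlace F → ℍ)`. [cite: Freitag1990, Ch. II §3 p. 91] -/
theorem measurable_prod_traceTerm_toPoint [IsTotallyReal F] (r : ℕ) (M : SL(2, F)) :
    Measurable fun ζ : RealPlace F → ℍ ↦ ∏ σ : F →+* ℝ, traceTerm r (σ (M 0 0)) (σ (M 0 1)) (σ (M 1 0)) (σ (M 1 1))
      (toPoint ζ σ) := by
  refine Finset.measurable_prod _ fun σ _ ↦ ?_
  have hσ : Measurable fun ζ : RealPlace F → ℍ ↦ toPoint ζ σ := by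
    simp_rw [toPoint_apply]
    exact UpperHalfPlane.continuous_coe.measurable.comp (measurable_pi_apply _)
  exact (measurable_traceTerm r _ _ _ _).comp hσ

/-- `Γ − Γ_∞` is countable (`SL₂(F)` is). [folklore] -/
private theorem countable_offStabInfty (Γ : Subgroup SL(2, F)) : Countable {M : SL(2, F) // M ∈ Γ ∧ M 1 0 ≠ 0} := by
  haveI : Countable F := Finsupp.Countable.of_moduleFinite (R := ℚ)
  haveI : Countable (Matrix (Fin 2) (Fin 2) F) := inferInstanceAs (Countable (Fin 2 → Fin 2 → F))
  haveI : Countable SL(2, F) := Subtype.countable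
  exact Subtype.countable

/-! ## §2 Corollary 3.1₁ -/

/-- **`Σ_{M ∈ Γ−Γ_∞} ∫_V ‖k(M, z)‖ dω < ∞`** on the cusp sectors `V = V(Γ, C')`, `C' ≥ C₀`, `C' > 0` (`Γ ∼ Γ_K`, `r ≥ 2`):
Proposition 3.1's bound `Σ_M |k(M, z)| ≤ C` on `V` times `vol(V) < ∞`. [cite: Freitag1990, Ch. II §3 Corollary 3.1₁, p. 91] -/
theorem exists_forall_tsum_lintegral_cuspSector_enorm_prod_traceTerm_lt_top [IsTotallyReal F] {Γ : Subgroup SL(2, F)}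
    (hΓ : Γ.Commensurable (congruenceSubgroup (⊤ : Ideal (𝓞 F)))) {r : ℕ} (hr : 2 ≤ r) :
    ∃ C₀ : ℝ, ∀ C', C₀ ≤ C' → 0 < C' →
      ∑' M : {M : SL(2, F) // M ∈ Γ ∧ M 1 0 ≠ 0}, ∫⁻ ζ in (hasCuspInfty_of_commensurable_top hΓ).cuspSector C',
        ‖∏ σ : F →+* ℝ, traceTerm r (σ ((M : SL(2, F)) 0 0)) (σ ((M : SL(2, F)) 0 1)) (σ ((M : SL(2, F)) 1 0))
          (σ ((M : SL(2, F)) 1 1)) (toPoint ζ σ)‖ₑ < ∞ := by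
  haveI := countable_offStabInfty Γ
  obtain ⟨C₀, C, hC⟩ := exists_forall_cuspSector_tsum_norm_prod_traceTerm_offStabInfty_le hΓ hr
  refine ⟨C₀, fun C' hC' hC'0 ↦ ?_⟩
  set V := (hasCuspInfty_of_commensurable_top hΓ).cuspSector C' with hV
  set k : {M : SL(2, F) // M ∈ Γ ∧ M 1 0 ≠ 0} → (RealPlace F → ℍ) → ℂ := fun M ζ ↦
    ∏ σ : F →+* ℝ, traceTerm r (σ ((M : SL(2, F)) 0 0)) (σ ((M : SL(2, F)) 0 1)) (σ ((M : SL(2, F)) 1 0))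
      (σ ((M : SL(2, F)) 1 1)) (toPoint ζ σ) with hk
  have hmeas : ∀ M, Measurable (k M) := fun M ↦ measurable_prod_traceTerm_toPoint r _
  -- `Σ_M ∫⁻_V ‖k_M‖ = ∫⁻_V Σ_M ‖k_M‖ ≤ ∫⁻_V C = C·vol(V) < ∞`
  rw [← lintegral_tsum fun M ↦ (hmeas M).enorm.aemeasurable]
  have hpt : ∀ ζ ∈ V, ∑' M, ‖k M ζ‖ₑ ≤ ENNReal.ofReal C := by
    intro ζ hζ
    obtain ⟨hsum, hle⟩ := hC C' hC' ζ hζ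
    have h1 : ∑' M, ‖k M ζ‖ₑ = ENNReal.ofReal (∑' M, ‖k M ζ‖) := by
      rw [ENNReal.ofReal_tsum_of_nonneg (fun M ↦ norm_nonneg _) hsum]
      exact tsum_congr fun M ↦ (ofReal_norm (k M ζ)).symm
    rw [h1]
    exact ENNReal.ofReal_le_ofReal hle
  calc ∫⁻ ζ in V, ∑' M, ‖k M ζ‖ₑ ≤ ∫⁻ _ζ in V, ENNReal.ofReal C := setLIntegral_mono measurable_const hpt
    _ = ENNReal.ofReal C * volume V := setLIntegral_const V _
    _ < ∞ := ENNReal.mul_lt_top ENNReal.ofReal_lt_top (volume_cuspSector_lt_top _ hC'0)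

/-- **The sum of the norms `Σ_{M ∈ Γ−Γ_∞} |k(M, z)|` is integrable over `V(Γ, C')`** (`C' ≥ C₀`, `C' > 0`; `Γ ∼ Γ_K`, `r ≥ 2`).
[cite: Freitag1990, Ch. II §3 Corollary 3.1₁ with Proposition 3.1, p. 91] -/
theorem exists_forall_integrableOn_cuspSector_tsum_norm_prod_traceTerm [IsTotallyReal F] {Γ : Subgroup SL(2, F)}
    (hΓ : Γ.Commensurable (congruenceSubgroup (⊤ : Ideal (𝓞 F)))) {r : ℕ} (hr : 2 ≤ r) :
    ∃ C₀ : ℝ, ∀ C', C₀ ≤ C' → 0 < C' →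
      IntegrableOn (fun ζ : RealPlace F → ℍ ↦ ∑' M : {M : SL(2, F) // M ∈ Γ ∧ M 1 0 ≠ 0},
        ‖∏ σ : F →+* ℝ, traceTerm r (σ ((M : SL(2, F)) 0 0)) (σ ((M : SL(2, F)) 0 1)) (σ ((M : SL(2, F)) 1 0))
          (σ ((M : SL(2, F)) 1 1)) (toPoint ζ σ)‖) ((hasCuspInfty_of_commensurable_top hΓ).cuspSector C') := by
  haveI := countable_offStabInfty Γ
  obtain ⟨C₀, C, hC⟩ := exists_forall_cuspSector_tsum_norm_prod_traceTerm_offStabInfty_le hΓ hr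
  refine ⟨C₀, fun C' hC' hC'0 ↦ ?_⟩
  set V := (hasCuspInfty_of_commensurable_top hΓ).cuspSector C' with hV
  have hmeas : Measurable fun ζ : RealPlace F → ℍ ↦ ∑' M : {M : SL(2, F) // M ∈ Γ ∧ M 1 0 ≠ 0},
      ‖∏ σ : F →+* ℝ, traceTerm r (σ ((M : SL(2, F)) 0 0)) (σ ((M : SL(2, F)) 0 1)) (σ ((M : SL(2, F)) 1 0))
        (σ ((M : SL(2, F)) 1 1)) (toPoint ζ σ)‖ :=
    Measurable.tsum fun M ↦ (measurable_prod_traceTerm_toPoint r _).norm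
  refine ⟨hmeas.aestronglyMeasurable, ?_⟩
  rw [hasFiniteIntegral_iff_enorm]
  have hpt : ∀ ζ ∈ V, ‖∑' M : {M : SL(2, F) // M ∈ Γ ∧ M 1 0 ≠ 0},
      ‖∏ σ : F →+* ℝ, traceTerm r (σ ((M : SL(2, F)) 0 0)) (σ ((M : SL(2, F)) 0 1)) (σ ((M : SL(2, F)) 1 0))
        (σ ((M : SL(2, F)) 1 1)) (toPoint ζ σ)‖‖ₑ ≤ ENNReal.ofReal C := by
    intro ζ hζ
    obtain ⟨-, hle⟩ := hC C' hC' ζ hζ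
    rw [Real.enorm_eq_ofReal (tsum_nonneg fun M ↦ norm_nonneg _)]
    exact ENNReal.ofReal_le_ofReal hle
  calc ∫⁻ ζ in V, ‖∑' M : {M : SL(2, F) // M ∈ Γ ∧ M 1 0 ≠ 0},
        ‖∏ σ : F →+* ℝ, traceTerm r (σ ((M : SL(2, F)) 0 0)) (σ ((M : SL(2, F)) 0 1)) (σ ((M : SL(2, F)) 1 0))
          (σ ((M : SL(2, F)) 1 1)) (toPoint ζ σ)‖‖ₑ
      ≤ ∫⁻ _ζ in V, ENNReal.ofReal C := setLIntegral_mono measurable_const hpt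
    _ = ENNReal.ofReal C * volume V := setLIntegral_const V _
    _ < ∞ := ENNReal.mul_lt_top ENNReal.ofReal_lt_top (volume_cuspSector_lt_top _ hC'0)

/-- **Corollary 3.1₁: «the series `Σ_{M ∈ Γ−Γ_∞} k(M, z)` may be integrated term by term over `V_∞`»** —
`∫_V Σ_{M ∈ Γ−Γ_∞} k(M, z) dω = Σ_{M ∈ Γ−Γ_∞} ∫_V k(M, z) dω` on the cusp sectors `V = V(Γ, C')`, `C' ≥ C₀`, `C' > 0`
(`Γ ∼ Γ_K`, `r ≥ 2`). [cite: Freitag1990, Ch. II §3 Corollary 3.1₁, p. 91] -/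
theorem exists_forall_integral_cuspSector_tsum_prod_traceTerm [IsTotallyReal F] {Γ : Subgroup SL(2, F)}
    (hΓ : Γ.Commensurable (congruenceSubgroup (⊤ : Ideal (𝓞 F)))) {r : ℕ} (hr : 2 ≤ r) :
    ∃ C₀ : ℝ, ∀ C', C₀ ≤ C' → 0 < C' →
      ∫ ζ in (hasCuspInfty_of_commensurable_top hΓ).cuspSector C', ∑' M : {M : SL(2, F) // M ∈ Γ ∧ M 1 0 ≠ 0},
        ∏ σ : F →+* ℝ, traceTerm r (σ ((M : SL(2, F)) 0 0)) (σ ((M : SL(2, F)) 0 1)) (σ ((M : SL(2, F)) 1 0))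
          (σ ((M : SL(2, F)) 1 1)) (toPoint ζ σ) =
      ∑' M : {M : SL(2, F) // M ∈ Γ ∧ M 1 0 ≠ 0}, ∫ ζ in (hasCuspInfty_of_commensurable_top hΓ).cuspSector C',
        ∏ σ : F →+* ℝ, traceTerm r (σ ((M : SL(2, F)) 0 0)) (σ ((M : SL(2, F)) 0 1)) (σ ((M : SL(2, F)) 1 0))
          (σ ((M : SL(2, F)) 1 1)) (toPoint ζ σ) := by
  haveI := countable_offStabInfty Γ
  obtain ⟨C₀, hC₀⟩ := exists_forall_tsum_lintegral_cuspSector_enorm_prod_traceTerm_lt_top hΓ hr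
  exact ⟨C₀, fun C' hC' hC'0 ↦ integral_tsum (fun M ↦ (measurable_prod_traceTerm_toPoint r _).aestronglyMeasurable)
    (hC₀ C' hC' hC'0).ne⟩

/-- **Corollary 3.1₁, summability of the integrated terms**: `Σ_{M ∈ Γ−Γ_∞} ‖∫_V k(M, z) dω‖ < ∞`.
[cite: Freitag1990, Ch. II §3 Corollary 3.1₁, p. 91] -/
theorem exists_forall_summable_norm_integral_cuspSector_prod_traceTerm [IsTotallyReal F] {Γ : Subgroup SL(2, F)}
    (hΓ : Γ.Commensurable (congruenceSubgroup (⊤ : Ideal (𝓞 F)))) {r : ℕ} (hr : 2 ≤ r) :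
    ∃ C₀ : ℝ, ∀ C', C₀ ≤ C' → 0 < C' →
      Summable fun M : {M : SL(2, F) // M ∈ Γ ∧ M 1 0 ≠ 0} ↦
        ‖∫ ζ in (hasCuspInfty_of_commensurable_top hΓ).cuspSector C',
          ∏ σ : F →+* ℝ, traceTerm r (σ ((M : SL(2, F)) 0 0)) (σ ((M : SL(2, F)) 0 1)) (σ ((M : SL(2, F)) 1 0))
            (σ ((M : SL(2, F)) 1 1)) (toPoint ζ σ)‖ := by
  haveI := countable_offStabInfty Γ
  obtain ⟨C₀, hC₀⟩ := exists_forall_tsum_lintegral_cuspSector_enorm_prod_traceTerm_lt_top hΓ hr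
  refine ⟨C₀, fun C' hC' hC'0 ↦ ?_⟩
  set V := (hasCuspInfty_of_commensurable_top hΓ).cuspSector C' with hV
  set k : {M : SL(2, F) // M ∈ Γ ∧ M 1 0 ≠ 0} → (RealPlace F → ℍ) → ℂ := fun M ζ ↦
    ∏ σ : F →+* ℝ, traceTerm r (σ ((M : SL(2, F)) 0 0)) (σ ((M : SL(2, F)) 0 1)) (σ ((M : SL(2, F)) 1 0))
      (σ ((M : SL(2, F)) 1 1)) (toPoint ζ σ) with hk
  have hfin := hC₀ C' hC' hC'0
  -- `‖∫ k_M‖ ≤ (∫⁻ ‖k_M‖ₑ).toReal`, and the `toReal`s are summable since `Σ ∫⁻ < ∞`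
  have hle : ∀ M, ‖∫ ζ in V, k M ζ‖ ≤ (∫⁻ ζ in V, ‖k M ζ‖ₑ).toReal := fun M ↦ by
    rw [← integral_norm_eq_lintegral_enorm (measurable_prod_traceTerm_toPoint r _).aestronglyMeasurable]
    exact norm_integral_le_integral_norm _
  refine Summable.of_nonneg_of_le (fun M ↦ norm_nonneg _) hle ?_
  exact ENNReal.summable_toReal hfin.ne

end Literature.NumberTheory.Automorphic.HilbertModular
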